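import Summits.AtomisticToContinuum.FouriersLaw.Theorems.OddSectorIrreversibilityTapLeakBoundFloorSupWindow

/-!
# `TapLeakBound` (stmt-AtomisticToContinuum-15159), line `SketchIdeator2`, third floor of `stub_kickCone`: the log-window arithmetic

Helper file (`--supports stmt-AtomisticToContinuum-15159`) for crux P = `…Theses.OddSectorIrreversibility.TapLeakBound`,
registered stub `stub_kickCone` (C′, linear window — open). Third floor program (lead c3): the `N`-uniform kick cone in the
LOG window `s·(1 + log(1+d)) ≤ a·d`, by energy truncation at a cap growing only logarithmically, `E = c_E (2k)^4` with the
LOG INDEX `k = k(d) = 10 (⌊log₂(d+1)⌋ + 1)` (a natural number: `Nat.log 2 (d+1)`), priced by QUANTITATIVE Gibbs moments of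
order `k` (`K^m (m!)²`, …FloorMomentGrowth) through the sup-in-time maximal inequality (…FloorSupTail). This file is the pure
arithmetic of that choice (no measure theory):

* `one_le_logIndex`, `logIndex_le_linear` (`k ≤ 10(1+d)`), `cast_logIndex_le_log` (`k ≤ 20(1 + log(1+d))`),
  `half_pow_logIndex_le` (`(1/2)^k ≤ (1+d)^{-10}` — the Gibbs price at the cap is a tenth power);
* `factorial_two_mul_sq_le` (`((2k)!)² ≤ (2k)^{4k}` — Stirling-free; `(√√x)⁴ = x` is
  `Literature.NumberTheory.LFunctions.ZeroDensity.sqrt_sqrt_pow_four`, not restated here);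
* `logWindow_of_le` / `stub_floorLogWindow` — with `R = c·2k` (`c ≥ 1`, `A ≥ 1`): `s(1 + log(1+d)) ≤ (1280·A·c)⁻¹·d` gives the
  deterministic cone's window `32·A·R·s ≤ d` and `s ≤ 1 + d`.

References: folklore. Nothing here closes the item.
-/

noncomputable section

open Real

namespace Summit.AtomisticToContinuum.FouriersLaw.Theorems.OddSectorIrreversibility.TapLeak

/-! ### The log index `k(d) = 10 (Nat.log 2 (d+1) + 1)` -/

/-- `1 ≤ k(d)`. [folklore] -/
theorem one_le_logIndex (d : ℕ) : 1 ≤ 10 * (Nat.log 2 (d + 1) + 1) := by omega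

/-- `Nat.log 2 (d+1) ≤ d`. [folklore] -/
theorem natLog_two_succ_le (d : ℕ) : Nat.log 2 (d + 1) ≤ d := by
  have h1 : 2 ^ Nat.log 2 (d + 1) ≤ d + 1 := Nat.pow_log_le_self 2 (Nat.succ_ne_zero d)
  have h2 : Nat.log 2 (d + 1) < 2 ^ Nat.log 2 (d + 1) := Nat.lt_two_pow_self
  omega

/-- `k(d) ≤ 10 (1 + d)` (as reals). [folklore] -/
theorem logIndex_le_linear (d : ℕ) : ((10 * (Nat.log 2 (d + 1) + 1) : ℕ) : ℝ) ≤ 10 * (1 + (d : ℝ)) := by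
  have h := natLog_two_succ_le d
  have h' : ((10 * (Nat.log 2 (d + 1) + 1) : ℕ) : ℝ) ≤ ((10 * (d + 1) : ℕ) : ℝ) := by
    exact_mod_cast Nat.mul_le_mul_left 10 (Nat.add_le_add_right h 1)
  refine h'.trans (le_of_eq ?_)
  push_cast; ring

/-- `k(d) ≤ 20 (1 + log(1+d))` (as reals; `2^{Nat.log 2 (d+1)} ≤ d + 1` and `log 2 > 1/2`). [folklore] -/
theorem cast_logIndex_le_log (d : ℕ) :
    ((10 * (Nat.log 2 (d + 1) + 1) : ℕ) : ℝ) ≤ 20 * (1 + Real.log (1 + (d : ℝ))) := by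
  set L : ℕ := Nat.log 2 (d + 1) with hL
  have hd0 : (0 : ℝ) ≤ d := Nat.cast_nonneg d
  have h1d : (0 : ℝ) < 1 + d := by linarith
  have hpow : (2 : ℝ) ^ L ≤ 1 + (d : ℝ) := by
    have h : 2 ^ L ≤ d + 1 := Nat.pow_log_le_self 2 (Nat.succ_ne_zero d)
    have h' : ((2 ^ L : ℕ) : ℝ) ≤ ((d + 1 : ℕ) : ℝ) := by exact_mod_cast h
    push_cast at h'
    linarith
  have hlog : (L : ℝ) * Real.log 2 ≤ Real.log (1 + (d : ℝ)) := by
    rw [← Real.log_pow]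
    exact Real.log_le_log (by positivity) hpow
  have hlog2 : (1 / 2 : ℝ) < Real.log 2 := by
    have := Real.log_two_gt_d9; linarith
  have hlog0 : 0 ≤ Real.log (1 + (d : ℝ)) := Real.log_nonneg (by linarith)
  have hL2 : (L : ℝ) ≤ 2 * Real.log (1 + (d : ℝ)) := by
    have hL0 : (0 : ℝ) ≤ L := Nat.cast_nonneg L
    nlinarith
  have e : ((10 * (Nat.log 2 (d + 1) + 1) : ℕ) : ℝ) = 10 * ((L : ℝ) + 1) := by
    rw [hL]; push_cast; ring
  rw [e]
  nlinarith

/-- **The Gibbs price at the cap is a tenth power**: `(1/2)^{k(d)} ≤ 1/(1+d)^{10}` (`d + 1 < 2^{Nat.log 2 (d+1) + 1}`). [folklore] -/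
theorem half_pow_logIndex_le (d : ℕ) :
    (1 / 2 : ℝ) ^ (10 * (Nat.log 2 (d + 1) + 1)) ≤ 1 / (1 + (d : ℝ)) ^ 10 := by
  set L : ℕ := Nat.log 2 (d + 1) with hL
  have hd0 : (0 : ℝ) ≤ d := Nat.cast_nonneg d
  have h1d : (0 : ℝ) < 1 + d := by linarith
  have hlt : d + 1 < 2 ^ (L + 1) := Nat.lt_pow_succ_log_self Nat.one_lt_two (d + 1)
  have hlt' : (1 + (d : ℝ)) ≤ (2 : ℝ) ^ (L + 1) := by
    have h : ((d + 1 : ℕ) : ℝ) ≤ ((2 ^ (L + 1) : ℕ) : ℝ) := by exact_mod_cast hlt.le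
    push_cast at h
    linarith
  have hpow : (1 + (d : ℝ)) ^ 10 ≤ ((2 : ℝ) ^ (L + 1)) ^ 10 := pow_le_pow_left₀ h1d.le hlt' 10
  rw [one_div_pow, one_div_le_one_div (by positivity) (by positivity)]
  calc (1 + (d : ℝ)) ^ 10 ≤ ((2 : ℝ) ^ (L + 1)) ^ 10 := hpow
    _ = (2 : ℝ) ^ (10 * (L + 1)) := by rw [← pow_mul, mul_comm]

/-! ### Stirling-free factorial bound and the box scale -/

/-- `((2k)!)² ≤ (2k)^{4k}` (from `n! ≤ n^n`). [folklore] -/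
theorem factorial_two_mul_sq_le (k : ℕ) :
    ((Nat.factorial (2 * k) : ℕ) : ℝ) ^ 2 ≤ (((2 * k : ℕ) : ℝ)) ^ (4 * k) := by
  have h : Nat.factorial (2 * k) ≤ (2 * k) ^ (2 * k) := Nat.factorial_le_pow (2 * k)
  have h' : ((Nat.factorial (2 * k) : ℕ) : ℝ) ≤ (((2 * k : ℕ) : ℝ)) ^ (2 * k) := by exact_mod_cast h
  calc ((Nat.factorial (2 * k) : ℕ) : ℝ) ^ 2 ≤ ((((2 * k : ℕ) : ℝ)) ^ (2 * k)) ^ 2 :=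
        pow_le_pow_left₀ (Nat.cast_nonneg _) h' 2
    _ = (((2 * k : ℕ) : ℝ)) ^ (4 * k) := by rw [← pow_mul]; ring_nf

/-! ### The log window -/

/-- **The log window.** With `A ≥ 1`, `c ≥ 1`, the box scale `R = c · 2k(d)`, `d ≥ 1`, `s ≥ 0`: if
`s (1 + log(1+d)) ≤ (1280 A c)⁻¹ d` then `32 A R s ≤ d` and `s ≤ 1 + d` (`k(d) ≤ 20(1 + log(1+d))`). [folklore] -/
theorem logWindow_of_le {A c s : ℝ} (hA : 1 ≤ A) (hc : 1 ≤ c) (hs : 0 ≤ s) {d : ℕ} (hd : 1 ≤ d)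
    (hw : s * (1 + Real.log (1 + (d : ℝ))) ≤ (1280 * A * c)⁻¹ * d) :
    32 * A * (c * (2 * ((10 * (Nat.log 2 (d + 1) + 1) : ℕ) : ℝ))) * s ≤ d ∧ s ≤ 1 + (d : ℝ) := by
  set kR : ℝ := ((10 * (Nat.log 2 (d + 1) + 1) : ℕ) : ℝ) with hkR
  have hd1 : (1 : ℝ) ≤ d := by exact_mod_cast hd
  have hd0 : (0 : ℝ) ≤ d := by linarith
  have hA0 : 0 < A := by linarith
  have hc0 : 0 < c := by linarith
  have hK : (0 : ℝ) < 1280 * A * c := by positivity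
  have hlog0 : 0 ≤ Real.log (1 + (d : ℝ)) := Real.log_nonneg (by linarith)
  have hk : kR ≤ 20 * (1 + Real.log (1 + (d : ℝ))) := cast_logIndex_le_log d
  have hk0 : 0 ≤ kR := Nat.cast_nonneg _
  -- `s (1 + log(1+d)) ≤ d / (1280 A c)`
  have hw' : 1280 * A * c * (s * (1 + Real.log (1 + (d : ℝ)))) ≤ d := by
    have h := mul_le_mul_of_nonneg_left hw hK.le
    have e : 1280 * A * c * ((1280 * A * c)⁻¹ * (d : ℝ)) = d := by
      rw [← mul_assoc, mul_inv_cancel₀ hK.ne', one_mul]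
    linarith
  constructor
  · calc 32 * A * (c * (2 * kR)) * s = 64 * A * c * (kR * s) := by ring
      _ ≤ 64 * A * c * (20 * (1 + Real.log (1 + (d : ℝ))) * s) := by
          apply mul_le_mul_of_nonneg_left _ (by positivity)
          exact mul_le_mul_of_nonneg_right hk hs
      _ = 1280 * A * c * (s * (1 + Real.log (1 + (d : ℝ)))) := by ring
      _ ≤ d := hw'
  · have h1 : s ≤ s * (1 + Real.log (1 + (d : ℝ))) := by
      have : s * 1 ≤ s * (1 + Real.log (1 + (d : ℝ))) := mul_le_mul_of_nonneg_left (by linarith) hs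
      linarith
    have h2 : (1280 * A * c)⁻¹ * d ≤ d := by
      have hinv : (1280 * A * c)⁻¹ ≤ 1 := by
        rw [inv_le_one_iff₀]; right; nlinarith
      calc (1280 * A * c)⁻¹ * d ≤ 1 * d := mul_le_mul_of_nonneg_right hinv hd0
        _ = d := one_mul _
    linarith

/-! ### Registered sub-goal of the line (closed form of `logWindow_of_le`) -/

/-- **Sub-goal `stub_floorLogWindow`** (registered on the crux item for this helper file; closed `∀`-form of
`logWindow_of_le`): the log-window arithmetic of the third floor program. [folklore] -/
theorem stub_floorLogWindow : ∀ (A c s : ℝ), 1 ≤ A → 1 ≤ c → 0 ≤ s → ∀ (d : ℕ), 1 ≤ d → s * (1 + Real.log (1 + (d : ℝ))) ≤ (1280 * A * c)⁻¹ * d → 32 * A * (c * (2 * ((10 * (Nat.log 2 (d + 1) + 1) : ℕ) : ℝ))) * s ≤ d ∧ s ≤ 1 + (d : ℝ) :=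
  fun _ _ _ hA hc hs _ hd hw => logWindow_of_le hA hc hs hd hw

end Summit.AtomisticToContinuum.FouriersLaw.Theorems.OddSectorIrreversibility.TapLeak

end
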